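import Summits.AtomisticToContinuum.HydrodynamicLimit.Theorems.LambertianContactSwapLambertianWellPosedNoiseMass

/-!
# The one-window estimate of the Lambertian recursion

Helper file (`--supports`) of the support item `LambertianWellPosed` of route `LambertianContactSwap`
(`AtomisticToContinuum/HydrodynamicLimit`, stmt-AtomisticToContinuum-12101).
`(vol ⊗ γ^{⊗ℕ}) {q good for one window | (Λ_δ q, shifted noise) ∈ B} ≤ (vol ⊗ γ^{⊗ℕ}) B`: on the free
pieces the Lambertian window map is the deterministic one; on a hit piece it is the deterministic window
map of the pre-kicked datum `J_{ξs 0} z` with the noise shifted by one, and `vol ⊗ γ` is `J`-invariant on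
the good pair data (`lintegral_lambertKick`), so the deterministic estimate applies fibrewise.
-/

noncomputable section

open MeasureTheory ProbabilityTheory Set Function Filter Metric
open scoped ENNReal InnerProductSpace Real

namespace Summit.AtomisticToContinuum.HydrodynamicLimit.Theorems

open Literature.MathematicalPhysics.KineticTheory Literature.Analysis.FluidPDE
  Literature.Analysis.FluidPDE.Alexander

open LWindow

namespace HalfAngle

section WindowEstimate

variable {N : ℕ} {ε r δ V : ℝ}

/-- Transfer of the deterministic one-window estimate to the product with the noise: for measurable
`B ⊆ Config × (ℕ → ℝ³)` and a measurable `S` inside the short-time good part of an energy shell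
(interaction length `2Vδ`), `∫_S γ^ℕ{η | (Φ_δ z, η) ∈ B} dz ≤ (vol ⊗ γ^ℕ)(B)` (Tonelli and
`Alexander.volume_shortGood_inter_preimage_fwdFlow_le` fibrewise). [folklore] -/
theorem lintegral_noiseMass_fwdFlow_le (hε : 0 < ε) (hεr : ε + 2 * (2 * V * δ) < 2⁻¹) (hV0 : 0 ≤ V) (hδ : 0 ≤ δ)
    {B : Set (Config N (Fin 3) (UnitAddTorus (Fin 3)) × (ℕ → EuclideanSpace ℝ (Fin 3)))} (hB : MeasurableSet B)
    {S : Set (Config N (Fin 3) (UnitAddTorus (Fin 3)))}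
    (hSsub : S ⊆ shortGood N ε (2 * V * δ) δ ∩ {z | configEnergy z ≤ V ^ 2 / 2}) :
    ∫⁻ z in S, lambertNoise (Fin 3) (Prod.mk (fwdFlow (Torus.geometry (Fin 3)) ε z δ) ⁻¹' B) ≤
      ((volume : Measure (Config N (Fin 3) (UnitAddTorus (Fin 3)))).prod (lambertNoise (Fin 3))) B := by
  haveI : SigmaFinite (volume : Measure (UnitAddTorus (Fin 3) × EuclideanSpace ℝ (Fin 3))) := inferInstance
  haveI : SigmaFinite (volume : Measure (Config N (Fin 3) (UnitAddTorus (Fin 3)))) := by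
    rw [volume_pi]; infer_instance
  have hGr := Torus.isHardSphereRegular_geometry (d := Fin 3) (by linarith [mul_nonneg (mul_nonneg two_pos.le hV0) hδ] : ε < 2⁻¹)
  have hGm : (Torus.geometry (Fin 3)).IsMeasurable := Torus.isMeasurable_geometry
  have hTm : Measurable fun q : Config N (Fin 3) (UnitAddTorus (Fin 3)) × (ℕ → EuclideanSpace ℝ (Fin 3)) =>
      (fwdFlow (Torus.geometry (Fin 3)) ε q.1 δ, q.2) :=
    ((measurable_fwdFlow hGr hGm δ).comp measurable_fst).prodMk measurable_snd
  have h1 : ∫⁻ z in S, lambertNoise (Fin 3) (Prod.mk (fwdFlow (Torus.geometry (Fin 3)) ε z δ) ⁻¹' B) =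
      ((volume.restrict S).prod (lambertNoise (Fin 3)))
        ((fun q : Config N (Fin 3) (UnitAddTorus (Fin 3)) × (ℕ → EuclideanSpace ℝ (Fin 3)) =>
          (fwdFlow (Torus.geometry (Fin 3)) ε q.1 δ, q.2)) ⁻¹' B) := by
    rw [Measure.prod_apply (hTm hB)]
    rfl
  rw [h1, Measure.prod_apply_symm (hTm hB), Measure.prod_apply_symm hB]
  refine lintegral_mono fun η => ?_
  have hBη : MeasurableSet ((fun y : Config N (Fin 3) (UnitAddTorus (Fin 3)) => (y, η)) ⁻¹' B) := measurable_prodMk_right hB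
  have hX : MeasurableSet ((fun z : Config N (Fin 3) (UnitAddTorus (Fin 3)) => (z, η)) ⁻¹'
      ((fun q : Config N (Fin 3) (UnitAddTorus (Fin 3)) × (ℕ → EuclideanSpace ℝ (Fin 3)) =>
        (fwdFlow (Torus.geometry (Fin 3)) ε q.1 δ, q.2)) ⁻¹' B)) := (measurable_fwdFlow hGr hGm δ) hBη
  rw [Measure.restrict_apply hX]
  refine le_trans (measure_mono fun z hz => ?_) (volume_shortGood_inter_preimage_fwdFlow_le hε hεr le_rfl hV0 hδ hBη)
  exact ⟨(hSsub hz.2).1, (hSsub hz.2).2, hz.1⟩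

/-- **The Lambertian flow over a short window does not lose `vol ⊗ γ^ℕ`**: for measurable
`B ⊆ Config × (ℕ → ℝ³)`, the pairs (datum, noise) with datum in the short-time good part of the energy shell
`E ≤ V²/2` (interaction length `r ≥ 4Vδ`, `ε + 2r < 1/2`) and non-degenerate first redraw, whose
time-`δ` Lambertian state TOGETHER WITH THE SHIFTED NOISE `(Λ_δ(z; ξs), ξs (· + K_δ))` lies in `B`, have
measure at most `(vol ⊗ γ^ℕ)(B)`. No-collision pieces: the identity on the noise and the free flight; hit
pieces: `Λ_δ = Φ_δ ∘ J`, one noise consumed (`lambertNoise ≅ γ ⊗ lambertNoise`), and `J` preserves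
`vol ⊗ γ` into the hit pieces of length `2Vδ` (`HalfAngle.lintegral_lambertKick`); everything lands in the
short-time good set of length `2Vδ`, where the deterministic estimate applies fibrewise. [folklore] -/
theorem lambert_window_measure_le (hε : 0 < ε) (hεr : ε + 2 * r < 2⁻¹) (hr4 : 4 * V * δ ≤ r) (hV0 : 0 ≤ V)
    (hδ : 0 ≤ δ) {B : Set (Config N (Fin 3) (UnitAddTorus (Fin 3)) × (ℕ → EuclideanSpace ℝ (Fin 3)))}
    (hB : MeasurableSet B) :
    ((volume : Measure (Config N (Fin 3) (UnitAddTorus (Fin 3)))).prod (lambertNoise (Fin 3)))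
      {q | q.1 ∈ shortGood N ε r δ ∧ configEnergy q.1 ≤ V ^ 2 / 2 ∧
        (∀ pr : Fin N × Fin N, lambertDir ((Torus.geometry (Fin 3)).sepVec
          (freeFlight (Torus.geometry (Fin 3)) (freeExitTime (Torus.geometry (Fin 3)) ε q.1).toReal q.1 pr.1).1
          (freeFlight (Torus.geometry (Fin 3)) (freeExitTime (Torus.geometry (Fin 3)) ε q.1).toReal q.1 pr.2).1) (q.2 0) ≠ 0) ∧
        (lambertFlow (Torus.geometry (Fin 3)) ε q.2 q.1 δ,
          fun n => q.2 (n + lambertCount (Torus.geometry (Fin 3)) ε q.2 q.1 δ)) ∈ B} ≤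
    ((volume : Measure (Config N (Fin 3) (UnitAddTorus (Fin 3)))).prod (lambertNoise (Fin 3))) B := by
  have hVδ : 0 ≤ 2 * V * δ := by positivity
  have hrr : 2 * V * δ ≤ r := by nlinarith
  have hε' : ε < 2⁻¹ := by linarith
  have hεr' : ε + 2 * (2 * V * δ) < 2⁻¹ := by linarith
  have hGr := Torus.isHardSphereRegular_geometry (d := Fin 3) hε'
  have hGm : (Torus.geometry (Fin 3)).IsMeasurable := Torus.isMeasurable_geometry
  obtain ⟨hPm, hPdisj, hPsub⟩ := modPiece_disjoint_subset (N := N) hε hεr hr4 hV0 hδ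
  set P : Option ((Fin N × Fin N) × Bool) → Set (Config N (Fin 3) (UnitAddTorus (Fin 3))) := fun ι =>
    ι.elim (farSet N ε r) (fun pb => if pb.1.1 < pb.1.2 then
      (if pb.2 = true then hitPiece N ε (2 * V * δ) δ pb.1.1 pb.1.2 else noHitPiece N ε r δ pb.1.1 pb.1.2) else ∅)
    with hP
  set shell : Set (Config N (Fin 3) (UnitAddTorus (Fin 3))) := {z | configEnergy z ≤ V ^ 2 / 2} with hshell
  have hshellm : MeasurableSet shell := measurableSet_energyShell _
  -- the noise mass of the fibres of `B`
  set g : Config N (Fin 3) (UnitAddTorus (Fin 3)) → ℝ≥0∞ := fun y => lambertNoise (Fin 3) (Prod.mk y ⁻¹' B) with hg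
  have hgm : Measurable g := measurable_noiseMass hB
  have hgFm : Measurable fun z : Config N (Fin 3) (UnitAddTorus (Fin 3)) => g (fwdFlow (Torus.geometry (Fin 3)) ε z δ) :=
    hgm.comp (measurable_fwdFlow hGr hGm δ)
  -- the pre-kick of a pair, made opaque
  obtain ⟨J, hJ⟩ : ∃ J : Fin N × Fin N → EuclideanSpace ℝ (Fin 3) → Config N (Fin 3) (UnitAddTorus (Fin 3)) →
      Config N (Fin 3) (UnitAddTorus (Fin 3)), J = fun pr ξ z => freeFlight (Torus.geometry (Fin 3))
        (-pairHitTime ε ((Torus.geometry (Fin 3)).sepVec (z pr.1).1 (z pr.2).1) ((z pr.1).2 - (z pr.2).2))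
        (collidePair (Torus.geometry (Fin 3)) pr.1 pr.2 (lambertPair (Torus.geometry (Fin 3)) pr.1 pr.2
          (freeFlight (Torus.geometry (Fin 3))
            (pairHitTime ε ((Torus.geometry (Fin 3)).sepVec (z pr.1).1 (z pr.2).1) ((z pr.1).2 - (z pr.2).2)) z) ξ)) := ⟨_, rfl⟩
  have hJm : ∀ pr : Fin N × Fin N, Measurable fun q : Config N (Fin 3) (UnitAddTorus (Fin 3)) × EuclideanSpace ℝ (Fin 3) =>
      J pr q.2 q.1 := by
    intro pr; rw [hJ]; beta_reduce; exact measurable_lambertKick ε pr.1 pr.2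
  -- the non-degeneracy set
  set ND : Set (Config N (Fin 3) (UnitAddTorus (Fin 3)) × EuclideanSpace ℝ (Fin 3)) := {q | ∀ pr : Fin N × Fin N,
      lambertDir ((Torus.geometry (Fin 3)).sepVec
        (freeFlight (Torus.geometry (Fin 3)) (freeExitTime (Torus.geometry (Fin 3)) ε q.1).toReal q.1 pr.1).1
        (freeFlight (Torus.geometry (Fin 3)) (freeExitTime (Torus.geometry (Fin 3)) ε q.1).toReal q.1 pr.2).1) q.2 ≠ 0} with hND
  have hNDm : MeasurableSet ND := by
    have h := (measurableSet_degenerateRedraw (N := N) hGr hGm).compl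
    convert h using 1
    ext q; simp only [hND, mem_setOf_eq, mem_compl_iff, not_exists]
  -- the condition sets and the covering sets
  set Cfree : Set (Config N (Fin 3) (UnitAddTorus (Fin 3)) × (ℕ → EuclideanSpace ℝ (Fin 3))) :=
    {q | (fwdFlow (Torus.geometry (Fin 3)) ε q.1 δ, q.2) ∈ B} with hCfree
  set Chit : Fin N × Fin N → Set (Config N (Fin 3) (UnitAddTorus (Fin 3)) × (ℕ → EuclideanSpace ℝ (Fin 3))) := fun pr =>
    {q | (q.1, q.2 0) ∈ ND ∧ (fwdFlow (Torus.geometry (Fin 3)) ε (J pr (q.2 0) q.1) δ, fun n => q.2 (n + 1)) ∈ B} with hChit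
  have hTm : Measurable fun q : Config N (Fin 3) (UnitAddTorus (Fin 3)) × (ℕ → EuclideanSpace ℝ (Fin 3)) =>
      (fwdFlow (Torus.geometry (Fin 3)) ε q.1 δ, q.2) := ((measurable_fwdFlow hGr hGm δ).comp measurable_fst).prodMk measurable_snd
  have hCfreem : MeasurableSet Cfree := hTm hB
  have hhead : Measurable fun q : Config N (Fin 3) (UnitAddTorus (Fin 3)) × (ℕ → EuclideanSpace ℝ (Fin 3)) => (q.1, q.2 0) :=
    measurable_fst.prodMk ((measurable_pi_apply 0).comp measurable_snd)
  have hChitm : ∀ pr, MeasurableSet (Chit pr) := by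
    intro pr
    refine (hNDm.preimage hhead).inter ?_
    exact ((measurable_fwdFlow hGr hGm δ).comp ((hJm pr).comp hhead)).prodMk ((measurable_tail (Fin 3)).comp measurable_snd) hB
  set F : Option ((Fin N × Fin N) × Bool) → Set (Config N (Fin 3) (UnitAddTorus (Fin 3)) × (ℕ → EuclideanSpace ℝ (Fin 3))) :=
    fun ι => {q | q.1 ∈ shortPiece N ε r δ ι ∩ shell} ∩ ι.elim Cfree (fun pb => if pb.2 = true then Chit pb.1 else Cfree) with hF
  have hFm : ∀ ι, MeasurableSet (F ι) := by
    intro ι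
    refine (measurable_fst ((measurableSet_shortPiece ι).inter hshellm)).inter ?_
    rcases ι with _ | ⟨pr, b⟩
    · exact hCfreem
    · show MeasurableSet (if b = true then Chit pr else Cfree)
      split_ifs
      · exact hChitm pr
      · exact hCfreem
  -- Step 1: the window analysis covers the event by the sets `F ι`
  have hcover : {q : Config N (Fin 3) (UnitAddTorus (Fin 3)) × (ℕ → EuclideanSpace ℝ (Fin 3)) |
      q.1 ∈ shortGood N ε r δ ∧ configEnergy q.1 ≤ V ^ 2 / 2 ∧
        (∀ pr : Fin N × Fin N, lambertDir ((Torus.geometry (Fin 3)).sepVec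
          (freeFlight (Torus.geometry (Fin 3)) (freeExitTime (Torus.geometry (Fin 3)) ε q.1).toReal q.1 pr.1).1
          (freeFlight (Torus.geometry (Fin 3)) (freeExitTime (Torus.geometry (Fin 3)) ε q.1).toReal q.1 pr.2).1) (q.2 0) ≠ 0) ∧
        (lambertFlow (Torus.geometry (Fin 3)) ε q.2 q.1 δ,
          fun n => q.2 (n + lambertCount (Torus.geometry (Fin 3)) ε q.2 q.1 δ)) ∈ B} ⊆ ⋃ ι, F ι := by
    rintro ⟨z, ξs⟩ ⟨hz, hE, hnd, hΨ⟩
    simp only [mem_iUnion]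
    have hV : ∀ k, ‖(z k).2‖ ≤ V := norm_vel_le_of_configEnergy_le hV0 hE
    rcases mem_shortGood.1 hz with hfar | ⟨pr, hpr, hno | hhit⟩
    · refine ⟨none, ⟨hfar, hE⟩, ?_⟩
      have H := forall_lt_norm_of_mem_farSet hV hrr hfar
      obtain ⟨-, -, -, hflow, hcount⟩ := lambert_window_free hε' hδ H ξs
      show (fwdFlow (Torus.geometry (Fin 3)) ε z δ, ξs) ∈ B
      rw [hflow δ ⟨hδ, le_rfl⟩, hcount] at hΨ
      simpa using hΨ
    · refine ⟨some (pr, false), ⟨?_, hE⟩, ?_⟩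
      · simp only [shortPiece, if_pos hpr]; exact hno
      · show (z, ξs) ∈ (if false = true then Chit pr else Cfree)
        rw [if_neg Bool.false_ne_true]
        have H := forall_lt_norm_of_mem_noHitPiece hε hV hrr hεr hno
        obtain ⟨-, -, -, hflow, hcount⟩ := lambert_window_free hε' hδ H ξs
        show (fwdFlow (Torus.geometry (Fin 3)) ε z δ, ξs) ∈ B
        rw [hflow δ ⟨hδ, le_rfl⟩, hcount] at hΨ
        simpa using hΨ
    · have hh : HitHyp ε r δ V z pr.1 pr.2 := ⟨hε, hεr, hrr, hV0, hE, hpr, hhit⟩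
      have hξ : lambertDir (hitPoint ε ((Torus.geometry (Fin 3)).sepVec (z pr.1).1 (z pr.2).1,
          (z pr.1).2 - (z pr.2).2)) (ξs 0) ≠ 0 := by
        have := hnd pr
        rwa [hh.toReal_freeExitTime, hh.sepVec_freeFlight_hitTime] at this
      obtain ⟨-, -, -, hflow, hcount⟩ := lambert_window_hit hh hr4 hξ
      refine ⟨some (pr, true), ⟨?_, hE⟩, ?_⟩
      · simp only [shortPiece, if_pos hpr]; exact hhit
      · show (z, ξs) ∈ (if true = true then Chit pr else Cfree)
        rw [if_pos rfl]
        refine ⟨hnd, ?_⟩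
        show (fwdFlow (Torus.geometry (Fin 3)) ε (J pr (ξs 0) z) δ, fun n => ξs (n + 1)) ∈ B
        rw [hflow, hcount] at hΨ
        rw [hJ]
        exact hΨ
  -- Step 2: each covering set has measure at most `∫_{P ι ∩ shell} g ∘ Φ_δ`
  haveI : SigmaFinite (volume : Measure (UnitAddTorus (Fin 3) × EuclideanSpace ℝ (Fin 3))) := inferInstance
  haveI : SigmaFinite (volume : Measure (Config N (Fin 3) (UnitAddTorus (Fin 3)))) := by
    rw [volume_pi]; infer_instance
  -- sections of the free covering sets
  have free_section : ∀ (T : Set (Config N (Fin 3) (UnitAddTorus (Fin 3)))) (z : Config N (Fin 3) (UnitAddTorus (Fin 3))),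
      lambertNoise (Fin 3) (Prod.mk z ⁻¹' ({q : Config N (Fin 3) (UnitAddTorus (Fin 3)) × (ℕ → EuclideanSpace ℝ (Fin 3)) |
        q.1 ∈ T} ∩ Cfree)) = T.indicator (fun z => g (fwdFlow (Torus.geometry (Fin 3)) ε z δ)) z := by
    intro T z
    by_cases hzT : z ∈ T
    · rw [indicator_of_mem hzT, hg]
      congr 1
      ext ξs
      simp only [mem_preimage, mem_inter_iff, mem_setOf_eq, hCfree]
      exact ⟨fun h => h.2, fun h => ⟨hzT, h⟩⟩
    · rw [indicator_of_notMem hzT]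
      have : Prod.mk z ⁻¹' ({q : Config N (Fin 3) (UnitAddTorus (Fin 3)) × (ℕ → EuclideanSpace ℝ (Fin 3)) |
          q.1 ∈ T} ∩ Cfree) = ∅ := by
        ext ξs; simp only [mem_preimage, mem_inter_iff, mem_setOf_eq, mem_empty_iff_false, iff_false]
        exact fun h => hzT h.1
      rw [this, measure_empty]
  -- sections of the hit covering sets, through `γ^ℕ ≅ γ ⊗ γ^ℕ`
  set Ghit : Fin N × Fin N → Config N (Fin 3) (UnitAddTorus (Fin 3)) → ℝ≥0∞ := fun pr =>
    (hitPiece N ε (2 * V * δ) δ pr.1 pr.2 ∩ shell).indicator (fun y => g (fwdFlow (Torus.geometry (Fin 3)) ε y δ)) with hGhit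
  have hGhitm : ∀ pr, Measurable (Ghit pr) := fun pr => hgFm.indicator ((measurableSet_hitPiece ε _ δ pr.1 pr.2).inter hshellm)
  have hit_section : ∀ (pr : Fin N × Fin N), pr.1 < pr.2 → ∀ z ∈ hitPiece N ε r δ pr.1 pr.2 ∩ shell,
      lambertNoise (Fin 3) (Prod.mk z ⁻¹' ({q : Config N (Fin 3) (UnitAddTorus (Fin 3)) × (ℕ → EuclideanSpace ℝ (Fin 3)) |
        q.1 ∈ hitPiece N ε r δ pr.1 pr.2 ∩ shell} ∩ Chit pr)) ≤
        ∫⁻ ξ, Ghit pr (J pr ξ z) ∂(stdGaussian (EuclideanSpace ℝ (Fin 3))) := by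
    intro pr hpr z hz
    have hh : HitHyp ε r δ V z pr.1 pr.2 := ⟨hε, hεr, hrr, hV0, hz.2, hpr, hz.1⟩
    -- the event as a (head, tail) event
    set Cz : Set (EuclideanSpace ℝ (Fin 3) × (ℕ → EuclideanSpace ℝ (Fin 3))) :=
      {x | (z, x.1) ∈ ND ∧ (fwdFlow (Torus.geometry (Fin 3)) ε (J pr x.1 z) δ, x.2) ∈ B} with hCz
    have hCzm : MeasurableSet Cz := by
      refine (hNDm.preimage (measurable_const.prodMk measurable_fst)).inter ?_
      exact (((measurable_fwdFlow hGr hGm δ).comp ((hJm pr).comp (measurable_const.prodMk measurable_fst))).prodMk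
        measurable_snd) hB
    have hset : Prod.mk z ⁻¹' ({q : Config N (Fin 3) (UnitAddTorus (Fin 3)) × (ℕ → EuclideanSpace ℝ (Fin 3)) |
        q.1 ∈ hitPiece N ε r δ pr.1 pr.2 ∩ shell} ∩ Chit pr) =
        (fun ξs : ℕ → EuclideanSpace ℝ (Fin 3) => (ξs 0, fun m : ℕ => ξs (m + 1))) ⁻¹' Cz := by
      ext ξs
      simp only [mem_preimage, mem_inter_iff, mem_setOf_eq, hChit, hCz]
      exact ⟨fun h => h.2, fun h => ⟨hz, h⟩⟩
    rw [hset, ← Measure.map_apply ((measurable_pi_apply 0).prodMk (measurable_tail (Fin 3))) hCzm,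
      lambertNoise_map_headTail, Measure.prod_apply hCzm]
    refine lintegral_mono fun ξ => ?_
    by_cases hndξ : (z, ξ) ∈ ND
    · have hξ : lambertDir (hitPoint ε ((Torus.geometry (Fin 3)).sepVec (z pr.1).1 (z pr.2).1,
          (z pr.1).2 - (z pr.2).2)) ξ ≠ 0 := by
        have := hndξ pr
        rwa [hh.toReal_freeExitTime, hh.sepVec_freeFlight_hitTime] at this
      obtain ⟨hHJ, -, -⟩ := hitHyp_lambertKick hh hr4 hξ
      have hJmem : J pr ξ z ∈ hitPiece N ε (2 * V * δ) δ pr.1 pr.2 ∩ shell := by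
        rw [hJ]; exact ⟨hHJ.mem, hHJ.energy⟩
      rw [hGhit]
      dsimp only
      rw [indicator_of_mem hJmem, hg]
      refine le_of_eq ?_
      congr 1
      ext η
      simp only [mem_preimage, hCz, mem_setOf_eq]
      exact ⟨fun h => h.2, fun h => ⟨hndξ, h⟩⟩
    · have : Prod.mk ξ ⁻¹' Cz = ∅ := by
        ext η; simp only [mem_preimage, hCz, mem_setOf_eq, mem_empty_iff_false, iff_false]
        exact fun h => hndξ h.1
      rw [this, measure_empty]; exact bot_le
  -- hit data are good pair data of interaction scale `(δ, 2V)`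
  have hit_sub_M₀ : ∀ (pr : Fin N × Fin N), pr.1 < pr.2 → hitPiece N ε r δ pr.1 pr.2 ∩ shell ⊆
      {z : Config N (Fin 3) (UnitAddTorus (Fin 3)) |
        (((Torus.geometry (Fin 3)).sepVec (z pr.1).1 (z pr.2).1, (z pr.1).2 - (z pr.2).2) :
            EuclideanSpace ℝ (Fin 3) × EuclideanSpace ℝ (Fin 3)) ∈ billiardGood ε ∧
          pairHitTime ε ((Torus.geometry (Fin 3)).sepVec (z pr.1).1 (z pr.2).1) ((z pr.1).2 - (z pr.2).2) ≤ δ ∧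
          ‖(z pr.1).2 - (z pr.2).2‖ ≤ 2 * V} := by
    intro pr hpr z hz
    have hh : HitHyp ε r δ V z pr.1 pr.2 := ⟨hε, hεr, hrr, hV0, hz.2, hpr, hz.1⟩
    exact ⟨hh.good, hh.hitTime_le, norm_vel_sub_le hh.norm_vel_le _ _⟩
  have hbound : ∀ ι, ((volume : Measure (Config N (Fin 3) (UnitAddTorus (Fin 3)))).prod (lambertNoise (Fin 3))) (F ι) ≤
      ∫⁻ z in P ι ∩ shell, g (fwdFlow (Torus.geometry (Fin 3)) ε z δ) := by
    intro ι
    rw [Measure.prod_apply (hFm ι)]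
    rcases ι with _ | ⟨pr, b⟩
    · show ∫⁻ z, lambertNoise (Fin 3) (Prod.mk z ⁻¹' ({q : Config N (Fin 3) (UnitAddTorus (Fin 3)) ×
        (ℕ → EuclideanSpace ℝ (Fin 3)) | q.1 ∈ shortPiece N ε r δ none ∩ shell} ∩ Cfree)) ≤ _
      simp_rw [free_section]
      rw [lintegral_indicator ((measurableSet_shortPiece _).inter hshellm)]
      rfl
    · by_cases hpr : pr.1 < pr.2
      swap
      · have hempty : ∀ q : Config N (Fin 3) (UnitAddTorus (Fin 3)) × (ℕ → EuclideanSpace ℝ (Fin 3)),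
            q ∉ F (some (pr, b)) := by
          rintro q ⟨⟨hq, -⟩, -⟩
          rcases b <;> simp only [shortPiece, if_neg hpr] at hq <;> exact hq
        have : ∀ z : Config N (Fin 3) (UnitAddTorus (Fin 3)), Prod.mk z ⁻¹' F (some (pr, b)) = ∅ :=
          fun z => eq_empty_of_forall_notMem fun ξs h => hempty _ h
        simp_rw [this, measure_empty, lintegral_zero]
        exact bot_le
      cases b
      · show ∫⁻ z, lambertNoise (Fin 3) (Prod.mk z ⁻¹' ({q : Config N (Fin 3) (UnitAddTorus (Fin 3)) ×
          (ℕ → EuclideanSpace ℝ (Fin 3)) | q.1 ∈ shortPiece N ε r δ (some (pr, false)) ∩ shell} ∩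
            (if false = true then Chit pr else Cfree))) ≤ _
        rw [if_neg Bool.false_ne_true]
        simp_rw [free_section]
        rw [lintegral_indicator ((measurableSet_shortPiece _).inter hshellm)]
        refine le_of_eq ?_
        congr 2
      · show ∫⁻ z, lambertNoise (Fin 3) (Prod.mk z ⁻¹' ({q : Config N (Fin 3) (UnitAddTorus (Fin 3)) ×
          (ℕ → EuclideanSpace ℝ (Fin 3)) | q.1 ∈ shortPiece N ε r δ (some (pr, true)) ∩ shell} ∩
            (if true = true then Chit pr else Cfree))) ≤ _
        rw [if_pos rfl]
        have hpiece : shortPiece (d := Fin 3) N ε r δ (some (pr, true)) = hitPiece N ε r δ pr.1 pr.2 := by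
          simp only [shortPiece, if_pos hpr]
        have hP' : P (some (pr, true)) = hitPiece N ε (2 * V * δ) δ pr.1 pr.2 := by
          show (if pr.1 < pr.2 then (if true = true then hitPiece N ε (2 * V * δ) δ pr.1 pr.2
            else noHitPiece N ε r δ pr.1 pr.2) else ∅) = _
          rw [if_pos hpr, if_pos rfl]
        rw [hpiece, hP']
        have hHm : MeasurableSet (hitPiece N ε r δ pr.1 pr.2 ∩ shell) := (measurableSet_hitPiece ε r δ _ _).inter hshellm
        have hKm : Measurable fun z : Config N (Fin 3) (UnitAddTorus (Fin 3)) =>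
            ∫⁻ ξ, Ghit pr (J pr ξ z) ∂(stdGaussian (EuclideanSpace ℝ (Fin 3))) :=
          ((hGhitm pr).comp (hJm pr)).lintegral_prod_right'
        calc ∫⁻ z, lambertNoise (Fin 3) (Prod.mk z ⁻¹' ({q : Config N (Fin 3) (UnitAddTorus (Fin 3)) ×
              (ℕ → EuclideanSpace ℝ (Fin 3)) | q.1 ∈ hitPiece N ε r δ pr.1 pr.2 ∩ shell} ∩ Chit pr))
            ≤ ∫⁻ z, (hitPiece N ε r δ pr.1 pr.2 ∩ shell).indicator
                (fun z => ∫⁻ ξ, Ghit pr (J pr ξ z) ∂(stdGaussian (EuclideanSpace ℝ (Fin 3)))) z := by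
              refine lintegral_mono fun z => ?_
              by_cases hz : z ∈ hitPiece N ε r δ pr.1 pr.2 ∩ shell
              · rw [indicator_of_mem hz]; exact hit_section pr hpr z hz
              · rw [indicator_of_notMem hz]
                have : Prod.mk z ⁻¹' ({q : Config N (Fin 3) (UnitAddTorus (Fin 3)) × (ℕ → EuclideanSpace ℝ (Fin 3)) |
                    q.1 ∈ hitPiece N ε r δ pr.1 pr.2 ∩ shell} ∩ Chit pr) = ∅ := by
                  ext ξs; simp only [mem_preimage, mem_inter_iff, mem_setOf_eq, mem_empty_iff_false, iff_false]
                  exact fun h => hz h.1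
                rw [this, measure_empty]
          _ = ∫⁻ z in hitPiece N ε r δ pr.1 pr.2 ∩ shell, ∫⁻ ξ, Ghit pr (J pr ξ z) ∂(stdGaussian (EuclideanSpace ℝ (Fin 3))) :=
              lintegral_indicator hHm _
          _ ≤ ∫⁻ z in {z : Config N (Fin 3) (UnitAddTorus (Fin 3)) |
                (((Torus.geometry (Fin 3)).sepVec (z pr.1).1 (z pr.2).1, (z pr.1).2 - (z pr.2).2) :
                    EuclideanSpace ℝ (Fin 3) × EuclideanSpace ℝ (Fin 3)) ∈ billiardGood ε ∧
                  pairHitTime ε ((Torus.geometry (Fin 3)).sepVec (z pr.1).1 (z pr.2).1) ((z pr.1).2 - (z pr.2).2) ≤ δ ∧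
                  ‖(z pr.1).2 - (z pr.2).2‖ ≤ 2 * V},
                ∫⁻ ξ, Ghit pr (J pr ξ z) ∂(stdGaussian (EuclideanSpace ℝ (Fin 3))) :=
              lintegral_mono_set (hit_sub_M₀ pr hpr)
          _ = ∫⁻ z in {z : Config N (Fin 3) (UnitAddTorus (Fin 3)) |
                (((Torus.geometry (Fin 3)).sepVec (z pr.1).1 (z pr.2).1, (z pr.1).2 - (z pr.2).2) :
                    EuclideanSpace ℝ (Fin 3) × EuclideanSpace ℝ (Fin 3)) ∈ billiardGood ε ∧
                  pairHitTime ε ((Torus.geometry (Fin 3)).sepVec (z pr.1).1 (z pr.2).1) ((z pr.1).2 - (z pr.2).2) ≤ δ ∧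
                  ‖(z pr.1).2 - (z pr.2).2‖ ≤ 2 * V}, Ghit pr z := by
              have h := lintegral_lambertKick (R := 2 * V) hε hδ (by positivity) (by nlinarith) hpr.ne (hGhitm pr)
              rw [hJ]
              exact h
          _ ≤ ∫⁻ z, Ghit pr z := setLIntegral_le_lintegral _ _
          _ = ∫⁻ z in hitPiece N ε (2 * V * δ) δ pr.1 pr.2 ∩ shell, g (fwdFlow (Torus.geometry (Fin 3)) ε z δ) := by
              rw [hGhit]
              exact lintegral_indicator ((measurableSet_hitPiece ε _ δ _ _).inter hshellm) _
  -- Step 3: the targets are disjoint pieces of the short-time good set of length `2Vδ`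
  have hdisj : Pairwise (Disjoint on fun ι => P ι ∩ shell) := by
    intro ι κ hne
    rw [Function.onFun, disjoint_left]
    rintro z ⟨hzι, hE⟩ ⟨hzκ, -⟩
    exact hne (hPdisj ι κ z hE hzι hzκ)
  have hUsub : (⋃ ι, P ι ∩ shell) ⊆ shortGood N ε (2 * V * δ) δ ∩ shell :=
    iUnion_subset fun ι z hz => ⟨hPsub ι hz.1, hz.2⟩
  calc ((volume : Measure (Config N (Fin 3) (UnitAddTorus (Fin 3)))).prod (lambertNoise (Fin 3))) _
      ≤ ((volume : Measure (Config N (Fin 3) (UnitAddTorus (Fin 3)))).prod (lambertNoise (Fin 3))) (⋃ ι, F ι) :=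
        measure_mono hcover
    _ ≤ ∑ ι, ((volume : Measure (Config N (Fin 3) (UnitAddTorus (Fin 3)))).prod (lambertNoise (Fin 3))) (F ι) :=
        measure_iUnion_fintype_le _ _
    _ ≤ ∑ ι, ∫⁻ z in P ι ∩ shell, g (fwdFlow (Torus.geometry (Fin 3)) ε z δ) := Finset.sum_le_sum fun ι _ => hbound ι
    _ = ∫⁻ z in ⋃ ι, P ι ∩ shell, g (fwdFlow (Torus.geometry (Fin 3)) ε z δ) := by
        rw [lintegral_iUnion (fun ι => (hPm ι).inter hshellm) hdisj, tsum_fintype]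
    _ ≤ ∫⁻ z in shortGood N ε (2 * V * δ) δ ∩ shell, g (fwdFlow (Torus.geometry (Fin 3)) ε z δ) :=
        lintegral_mono_set hUsub
    _ ≤ _ := lintegral_noiseMass_fwdFlow_le hε hεr' hV0 hδ hB subset_rfl

end WindowEstimate

end HalfAngle

end Summit.AtomisticToContinuum.HydrodynamicLimit.Theorems
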